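import Summits.KontsevichZagierPeriods.KontsevichZagierPeriods.Theses.AttractorUnfolding
import Summits.KontsevichZagierPeriods.KontsevichZagierPeriods.Theses.AyoubSpecialisation
import Summits.KontsevichZagierPeriods.KontsevichZagierPeriods.Theses.KatzTower
import Summits.KontsevichZagierPeriods.KontsevichZagierPeriods.Theorems.TerasomaMultiplicationBetaCancellationOfAyoubPiCancellation

/-!
# `TwistProductRep` / `PiProductRep` / `DiscPadding` (shared support item stmt-KontsevichZagierPeriods-10941) — the three verbatim twins

The padding of an integral representation by the closed unit disc in two leading coordinates exists as an
operation `P : ∀ n, KZ.IntegralRep n → KZ.IntegralRep (n + 2)` with the literal domain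
`{z | z 0 ^ 2 + z 1 ^ 2 ≤ 1 ∧ (fun i => z i.succ.succ) ∈ r.domain}` and integrand `fun z => r.integrand (fun i => z i.succ.succ)`.
This is already a tree theorem, `Summit.KontsevichZagierPeriods.KontsevichZagierPeriods.BetaCancellationLine.exists_pinned`
(`Theorems/TerasomaMultiplicationBetaCancellationOfAyoubPiCancellation.lean`: `P n r := ([π] × r).reindex (Fin (2 + n) ≃ Fin (n + 2))`).
The item stmt-10941 is filed verbatim by three routes (AttractorUnfolding `TwistProductRep`, AyoubSpecialisation
`PiProductRep`, KatzTower `DiscPadding`); this file closes all three by that theorem (lead c10 of line `Sketch` of crux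
`TateLifting`, banking calculus theorems where they close items). No new mathematics.
-/

namespace Summit.KontsevichZagierPeriods.AttractorUnfolding

/-- Route `AttractorUnfolding`, item stmt-KontsevichZagierPeriods-10941: the disc-padding operation exists.
Proof: `BetaCancellationLine.exists_pinned`. [folklore] -/
theorem twistProductRep_proof :
    Summit.KontsevichZagierPeriods.KontsevichZagierPeriods.Theses.AttractorUnfolding.TwistProductRep :=
  Summit.KontsevichZagierPeriods.KontsevichZagierPeriods.BetaCancellationLine.exists_pinned

end Summit.KontsevichZagierPeriods.AttractorUnfolding

namespace Summit.KontsevichZagierPeriods.AyoubSpecialisation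

/-- Route `AyoubSpecialisation`, verbatim twin of stmt-KontsevichZagierPeriods-10941 (`PiProductRep`).
Proof: `BetaCancellationLine.exists_pinned`. [folklore] -/
theorem piProductRep_proof :
    Summit.KontsevichZagierPeriods.KontsevichZagierPeriods.Theses.AyoubSpecialisation.PiProductRep :=
  Summit.KontsevichZagierPeriods.KontsevichZagierPeriods.BetaCancellationLine.exists_pinned

end Summit.KontsevichZagierPeriods.AyoubSpecialisation

namespace Summit.KontsevichZagierPeriods.KatzTower

/-- Route `KatzTower`, verbatim twin of stmt-KontsevichZagierPeriods-10941 (`DiscPadding`).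
Proof: `BetaCancellationLine.exists_pinned`. [folklore] -/
theorem discPadding_proof :
    Summit.KontsevichZagierPeriods.KontsevichZagierPeriods.Theses.KatzTower.DiscPadding :=
  Summit.KontsevichZagierPeriods.KontsevichZagierPeriods.BetaCancellationLine.exists_pinned

end Summit.KontsevichZagierPeriods.KatzTower
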